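import Mathlib
import Literature.MathematicalPhysics.QuantumFieldTheory.Balaban1983to89.B10Eq70Squaring

/-!
# `Summit.QuantumFields.Balaban3D.Proofs.Multiplicity` — lane «pub-balaban3d» (Bałaban, CMP **102** (1985) 255–275, d = 3 lattice UV
# stability AS PRINTED), prover seat p2: the COVER MULTIPLICITY of the regions `Δ′(p′)` of (70)–(71) p. 273 — at one scale a
# fine site lies in the four-block region `Δ′` of at most FOUR plaquettes `p′` of a given orientation

HONEST FRAMING (lane PLAN.md §0).  Nothing of [B10] = [Balaban1985UV3] is asserted.  p. 273 L21–22: *«Δ′ = B^j(x₀) ∪ B^j(y₀) ∪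
B^j(z₀) ∪ B^j(w₀)»* (the four `j`-blocks at the corners of the large-field plaquette `p′`; the 4D cell's `B10Eq70Squaring.deltaBox n
(n • z₀) μ ν`, `n = L^j`).  The passage from the per-plaquette small factor (71) to the leaf «for all plaquettes in all large fields
set P» (`…Proofs.LargeFieldKnit.smallFactorsAll_of_perPlaquette`) needs the multiplicity `m` of the cover `{Δ′(j, p′)}`: this file
supplies its lattice half — for FIXED scale and orientation, the base blocks `z₀` with `y ∈ deltaBox n (n • z₀) μ ν` number at most
`4` (they are `⌊y/n⌋ − {0, e_μ, e_ν, e_μ + e_ν}`).  The other half (regions of different scales are disjoint because `Δ′(j, p′) ⊆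
Ω_j∖Ω_{j+1}`) is a property of the histories (seat p1's `Carriers.Histories`, lead ruling R-HIST′ (iv)).  Pure `ℤ^d` arithmetic.
-/

namespace Summit.QuantumFields.Balaban3D.Proofs.Multiplicity

open Literature.MathematicalPhysics.QuantumFieldTheory.Balaban1983to89
open B7Prop1Explicit (Site)
open B10Eq70Squaring (deltaBox side mem_deltaBox)
open Finset

variable {d : ℕ}

/-- Integer bookkeeping: if `0 ≤ y − n·z < n·c` (`0 < n`) then `y / n − z ∈ [0, c)` (Euclidean division). [folklore] -/
theorem ediv_sub_mem_range {y z n c : ℤ} (hn : 0 < n) (h0 : 0 ≤ y - n * z) (h1 : y - n * z < n * c) :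
    0 ≤ y / n - z ∧ y / n - z < c := by
  have hid : y / n = (y - n * z) / n + z := by
    have : y = (y - n * z) + z * n := by ring
    conv_lhs => rw [this]
    rw [Int.add_mul_ediv_right _ _ hn.ne']
  rw [hid, add_sub_cancel_right]
  exact ⟨Int.ediv_nonneg h0 hn.le, Int.ediv_lt_of_lt_mul hn (by linarith)⟩

/-- **At most four base blocks per fine site** (fixed scale `n = L^j` and orientation `μ ≠ ν`): among any finite set `Z` of base
blocks `z₀`, those whose region `Δ′ = deltaBox n (n • z₀) μ ν` (the four `j`-blocks at the corners of the plaquette at `n•z₀`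
spanned by `e_μ, e_ν`; p. 273 L21–22) contains the fine site `y` are among `⌊y/n⌋ − {0, e_μ, e_ν, e_μ + e_ν}`, hence number `≤ 4`.
[cite: Balaban1985UV3, (70)–(71) p.273] -/
theorem card_filter_mem_deltaBox_le_four {n : ℕ} (hn : 0 < n) {μ ν : Fin d} (hμν : μ ≠ ν) (y : Site d) (Z : Finset (Site d)) :
    (Z.filter (fun z₀ => y ∈ deltaBox n (n • z₀) μ ν)).card ≤ 4 := by
  classical
  have hnz : (0 : ℤ) < n := by exact_mod_cast hn
  -- the four candidates
  let F : Fin 2 × Fin 2 → Site d := fun ab κ =>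
    y κ / n - (if κ = μ then ((ab.1 : ℕ) : ℤ) else 0) - (if κ = ν then ((ab.2 : ℕ) : ℤ) else 0)
  have hsub : Z.filter (fun z₀ => y ∈ deltaBox n (n • z₀) μ ν) ⊆ (Finset.univ : Finset (Fin 2 × Fin 2)).image F := by
    intro z₀ hz₀
    rw [Finset.mem_filter] at hz₀
    have hmem := (mem_deltaBox n (n • z₀) μ ν).mp hz₀.2
    -- coordinatewise: 0 ≤ y κ − n z₀ κ < side κ
    have hcoord : ∀ κ, 0 ≤ y κ - n * z₀ κ ∧ y κ - n * z₀ κ < (side n μ ν κ : ℤ) := by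
      intro κ
      have h := hmem κ
      simp only [Pi.sub_apply, nsmul_eq_mul] at h
      exact_mod_cast h
    -- the offsets a = y μ / n − z₀ μ, b = y ν / n − z₀ ν lie in {0, 1}; the other coordinates are exact quotients
    have hμ : 0 ≤ y μ / n - z₀ μ ∧ y μ / n - z₀ μ < 2 := by
      have h := hcoord μ
      simp only [side, true_or, if_true, Nat.cast_mul, Nat.cast_ofNat] at h
      exact ediv_sub_mem_range hnz h.1 (by linarith [h.2])
    have hν : 0 ≤ y ν / n - z₀ ν ∧ y ν / n - z₀ ν < 2 := by
      have h := hcoord ν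
      simp only [side, or_true, if_true, Nat.cast_mul, Nat.cast_ofNat] at h
      exact ediv_sub_mem_range hnz h.1 (by linarith [h.2])
    have hκ : ∀ κ, κ ≠ μ → κ ≠ ν → y κ / n - z₀ κ = 0 := by
      intro κ hκμ hκν
      have h := hcoord κ
      simp only [side, hκμ, hκν, or_self, if_false] at h
      have h2 := ediv_sub_mem_range (c := 1) hnz h.1 (by linarith [h.2])
      omega
    obtain ⟨a, ha⟩ : ∃ a : Fin 2, ((a : ℕ) : ℤ) = y μ / n - z₀ μ :=
      ⟨⟨(y μ / n - z₀ μ).toNat, by omega⟩, by simp only []; omega⟩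
    obtain ⟨b, hb⟩ : ∃ b : Fin 2, ((b : ℕ) : ℤ) = y ν / n - z₀ ν :=
      ⟨⟨(y ν / n - z₀ ν).toNat, by omega⟩, by simp only []; omega⟩
    refine Finset.mem_image.mpr ⟨(a, b), Finset.mem_univ _, ?_⟩
    funext κ
    simp only [F]
    by_cases hκμ : κ = μ
    · subst hκμ
      rw [if_pos rfl, if_neg hμν, ha]; ring
    · by_cases hκν : κ = ν
      · subst hκν
        rw [if_neg hκμ, if_pos rfl, hb]; ring
      · rw [if_neg hκμ, if_neg hκν]
        have := hκ κ hκμ hκν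
        linarith
  calc (Z.filter (fun z₀ => y ∈ deltaBox n (n • z₀) μ ν)).card
      ≤ ((Finset.univ : Finset (Fin 2 × Fin 2)).image F).card := Finset.card_le_card hsub
    _ ≤ (Finset.univ : Finset (Fin 2 × Fin 2)).card := Finset.card_image_le
    _ = 4 := by simp

end Summit.QuantumFields.Balaban3D.Proofs.Multiplicity
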